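import Summits.CriticalPhenomena.PercolationContinuityZ3.Theorems.PercNearOneGluingNoHeavyLowerTailChampionStability
import HarnessLib

/-!
# `NoHeavyLowerTail` (stmt-CriticalPhenomena-4575) — the E-mass of a relay for a PAIR of observers is the bad mass of the glued
# observer plus the relay's gluing cost; validity is an upper set in glued lightness

Support file (prover `prim-hp-3`, hull-port line; `--supports stmt-CriticalPhenomena-4575`).  No definitions, no named facts, no sorries.

Notation: `μ_w = prodBernoulli w` on `Fin n`, relays `A`, level `j`, `π(v) = {z ∈ A : v ↔ z}`, `I_w(v) = μ_w{|π(v)| ≤ j}`;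
two observers `o₁ ≠ o₂` with `w s(o₁,o₂) = 0`, `O = {o₁,o₂}`, `π(O) = π(o₁) ∪ π(o₂)`; the glued weight function `w' = w[s(o₁,o₂) ↦ 1]`
(under `μ_{w'}` the two observers are a.s. one block); the E-mass of `v`, `E_w(v) = μ_w(v ↮ O, 1 ≤ |π(O)| ≤ j) + μ_w(v ↔ O, |π(v)| ≤ j)`.

* `HullPort.obsE_pair_add_glued_lightness` (**the E-form identity**): for every relay `v ∈ A`,
  `E_w(v) + I_{w'}(v) = bad_{w'}(o₁) + I_w(v)`, where `bad_{w'}(o₁) = μ_{w'}(1 ≤ |π(o₁)| ≤ j)` is the bad mass of the glued observer.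
  So `I_w(v) − E_w(v) = I_{w'}(v) − bad_{w'}(o₁)`: the champion-stability margin of `v` for the pair `O` in `w` equals the margin of
  `v` as a CIL witness for the single glued observer in `w'`; in particular the set of valid witnesses `{v : E_w(v) ≤ I_w(v)}` is an
  UPPER SET in the glued lightness `I_{w'}`.  Proof: `μ_{w'}(S) = μ_w((insert s(o₁,o₂))⁻¹ S)` (`ChampionStability.real_update_one_eq`) and
  the pointwise case split on `v ↔ O` (`ChampionStability.reachable_insert_left_iff`, `reachable_insert_iff_of_not`).
* `HullPort.obsE_le_of_valid_glued_heavier` (**transfer along glued lightness**): if `E_w(y) ≤ I_w(y)` for a relay `y ∈ A` and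
  `I_{w'}(y) ≤ I_{w'}(q)` for a relay `q ∈ A`, then `E_w(q) ≤ I_w(q)`.
WHY (crux notes `run/shared/lean/prim/prim-hp-3/HULLPORT-REF-gen6.md` §1–§3): together with the dominated-port step
(`HullPort.obsE_le_of_dominated_port_erase`, file `…DominatedPortStep.lean`) this is the induction step of TPS-domination for the
two-pendant-stars kernel: a relay `q` dominating the ports of `H` is valid as soon as, for ONE star edge `e`, it is glued-lighter in `H − e`
than some relay valid there (e.g. the lightest port of `H − e`, or `q` itself if it still dominates) — the empirical law GOOD-EDGE.
-/

noncomputable section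

namespace Summit.CriticalPhenomena.PercolationContinuityZ3.Theorems

open MeasureTheory Set Literature.Probability.LatticeModels Literature.Probability.Percolation
open scoped Classical BigOperators

variable {n : ℕ}

namespace HullPort

/-- After opening `s(o₁,o₂)`, the relay set of `o₁` is `π(o₁) ∪ π(o₂) = π({o₁,o₂})`. [folklore] -/
theorem filter_openConn_insert_left (A : Finset (Fin n)) {o₁ o₂ : Fin n} (h12 : o₁ ≠ o₂) (ω : BondConfig (Fin n)) :
    (A.filter fun z => insert s(o₁, o₂) ω ∈ openConn o₁ z) =
      (A.filter fun z => ∃ x ∈ ({o₁, o₂} : Finset (Fin n)), ω ∈ openConn x z) := by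
  apply Finset.filter_congr
  intro z _
  change (openGraph (insert s(o₁, o₂) ω)).Reachable o₁ z ↔ _
  rw [ChampionStability.reachable_insert_left_iff ω h12 z]
  constructor
  · rintro (h | h)
    · exact ⟨o₁, by simp, h⟩
    · exact ⟨o₂, by simp, h⟩
  · rintro ⟨x, hx, hxz⟩
    simp only [Finset.mem_insert, Finset.mem_singleton] at hx
    rcases hx with rfl | rfl
    · exact Or.inl hxz
    · exact Or.inr hxz

/-- After opening `s(o₁,o₂)`, a vertex joined to neither observer keeps its relay set. [folklore] -/
theorem filter_openConn_insert_of_not (A : Finset (Fin n)) {o₁ o₂ v : Fin n} (h12 : o₁ ≠ o₂) (ω : BondConfig (Fin n))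
    (hv : ∀ x ∈ ({o₁, o₂} : Finset (Fin n)), ω ∉ openConn v x) :
    (A.filter fun z => insert s(o₁, o₂) ω ∈ openConn v z) = (A.filter fun z => ω ∈ openConn v z) := by
  have h1 : ¬ (openGraph ω).Reachable v o₁ := hv o₁ (by simp)
  have h2 : ¬ (openGraph ω).Reachable v o₂ := hv o₂ (by simp)
  apply Finset.filter_congr
  intro z _
  change (openGraph (insert s(o₁, o₂) ω)).Reachable v z ↔ (openGraph ω).Reachable v z
  exact ChampionStability.reachable_insert_iff_of_not ω h12 h1 h2 z

/-- After opening `s(o₁,o₂)`, a vertex joined to one of the observers has the relay set `π({o₁,o₂})`. [folklore] -/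
theorem filter_openConn_insert_of_conn (A : Finset (Fin n)) {o₁ o₂ v : Fin n} (h12 : o₁ ≠ o₂) (ω : BondConfig (Fin n))
    (hv : ∃ x ∈ ({o₁, o₂} : Finset (Fin n)), ω ∈ openConn v x) :
    (A.filter fun z => insert s(o₁, o₂) ω ∈ openConn v z) =
      (A.filter fun z => ∃ x ∈ ({o₁, o₂} : Finset (Fin n)), ω ∈ openConn x z) := by
  -- `v ↔' o₁` in the enlarged configuration
  have hvo : (openGraph (insert s(o₁, o₂) ω)).Reachable v o₁ := by
    rw [ChampionStability.reachable_insert_to_left_iff ω h12 v]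
    obtain ⟨x, hx, hvx⟩ := hv
    simp only [Finset.mem_insert, Finset.mem_singleton] at hx
    rcases hx with rfl | rfl
    · exact Or.inl hvx
    · exact Or.inr hvx
  rw [← filter_openConn_insert_left A h12 ω]
  apply Finset.filter_congr
  intro z _
  change (openGraph (insert s(o₁, o₂) ω)).Reachable v z ↔ (openGraph (insert s(o₁, o₂) ω)).Reachable o₁ z
  exact ⟨fun h => hvo.symm.trans h, fun h => hvo.trans h⟩

/-- **The E-form identity for a pair of observers.**  `o₁ ≠ o₂`, `w s(o₁,o₂) = 0`, `v ∈ A`, `O = {o₁,o₂}`, `w' = w[s(o₁,o₂) ↦ 1]`: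
`E_w(v) + I_{w'}(v) = bad_{w'}(o₁) + I_w(v)`, i.e. `μ_w(v ↮ O, 1 ≤ |π(O)| ≤ j) + μ_w(v ↔ O, |π(v)| ≤ j) + μ_{w'}{|π(v)| ≤ j}
= μ_{w'}{1 ≤ |π(o₁)| ≤ j} + μ_w{|π(v)| ≤ j}`.  Hence `I_w(v) − E_w(v) = I_{w'}(v) − bad_{w'}(o₁)`: the validity of `v` as a witness for
the pair (`E_w(v) ≤ I_w(v)`) is the validity of `v` as a CIL witness for the glued observer, an upper set in glued lightness. [this work] -/
theorem obsE_pair_add_glued_lightness (w : Sym2 (Fin n) → unitInterval) (A : Finset (Fin n)) (o₁ o₂ v : Fin n) (j : ℕ)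
    (h12 : o₁ ≠ o₂) (hw : w s(o₁, o₂) = 0) (hv : v ∈ A) :
    (prodBernoulli w).real {ω : BondConfig (Fin n) | (∀ x ∈ ({o₁, o₂} : Finset (Fin n)), ω ∉ openConn v x) ∧
        1 ≤ (A.filter fun z => ∃ x ∈ ({o₁, o₂} : Finset (Fin n)), ω ∈ openConn x z).card ∧
        (A.filter fun z => ∃ x ∈ ({o₁, o₂} : Finset (Fin n)), ω ∈ openConn x z).card ≤ j} +
      (prodBernoulli w).real {ω : BondConfig (Fin n) | (∃ x ∈ ({o₁, o₂} : Finset (Fin n)), ω ∈ openConn v x) ∧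
        (A.filter fun z => ω ∈ openConn v z).card ≤ j} +
      (prodBernoulli (Function.update w s(o₁, o₂) 1)).real
        {ω : BondConfig (Fin n) | (A.filter fun z => ω ∈ openConn v z).card ≤ j} =
    (prodBernoulli (Function.update w s(o₁, o₂) 1)).real {ω : BondConfig (Fin n) |
        1 ≤ (A.filter fun z => ω ∈ openConn o₁ z).card ∧ (A.filter fun z => ω ∈ openConn o₁ z).card ≤ j} +
      (prodBernoulli w).real {ω : BondConfig (Fin n) | (A.filter fun z => ω ∈ openConn v z).card ≤ j} := by
  set O : Finset (Fin n) := {o₁, o₂} with hO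
  rw [ChampionStability.real_update_one_eq w hw, ChampionStability.real_update_one_eq w hw]
  set EA : Set (BondConfig (Fin n)) := {ω | (∀ x ∈ O, ω ∉ openConn v x) ∧
        1 ≤ (A.filter fun z => ∃ x ∈ O, ω ∈ openConn x z).card ∧
        (A.filter fun z => ∃ x ∈ O, ω ∈ openConn x z).card ≤ j} with hEA
  set EB : Set (BondConfig (Fin n)) := {ω | (∃ x ∈ O, ω ∈ openConn v x) ∧
        (A.filter fun z => ω ∈ openConn v z).card ≤ j} with hEB
  set X : Set (BondConfig (Fin n)) := {ω | (∃ x ∈ O, ω ∈ openConn v x) ∧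
        (A.filter fun z => ∃ x ∈ O, ω ∈ openConn x z).card ≤ j} with hX
  set Y : Set (BondConfig (Fin n)) := {ω | (∀ x ∈ O, ω ∉ openConn v x) ∧
        (A.filter fun z => ω ∈ openConn v z).card ≤ j} with hY
  set L : Set (BondConfig (Fin n)) := {ω | (A.filter fun z => ω ∈ openConn v z).card ≤ j} with hL
  -- membership of `v` in `π(O)` when `v ↔ O`
  have hvπ : ∀ ω : BondConfig (Fin n), (∃ x ∈ O, ω ∈ openConn v x) →
      1 ≤ (A.filter fun z => ∃ x ∈ O, ω ∈ openConn x z).card := by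
    intro ω ⟨x, hx, hvx⟩
    apply Finset.one_le_card.mpr
    refine ⟨v, ?_⟩
    rw [Finset.mem_filter]
    exact ⟨hv, x, hx, (hvx : (openGraph ω).Reachable v x).symm⟩
  have hnot : ∀ ω : BondConfig (Fin n), (¬ ∃ x ∈ O, ω ∈ openConn v x) ↔ (∀ x ∈ O, ω ∉ openConn v x) := by
    intro ω; push Not; rfl
  -- the three set identities
  have hB : (fun ω : BondConfig (Fin n) => insert s(o₁, o₂) ω) ⁻¹' {ω : BondConfig (Fin n) |
        1 ≤ (A.filter fun z => ω ∈ openConn o₁ z).card ∧ (A.filter fun z => ω ∈ openConn o₁ z).card ≤ j} = EA ∪ X := by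
    ext ω
    simp only [mem_preimage, mem_setOf_eq, mem_union, hEA, hX]
    rw [filter_openConn_insert_left A h12 ω]
    by_cases hc : ∃ x ∈ O, ω ∈ openConn v x
    · constructor
      · intro h; exact Or.inr ⟨hc, h.2⟩
      · rintro (h | h)
        · exact ⟨h.2.1, h.2.2⟩
        · exact ⟨hvπ ω hc, h.2⟩
    · have hc' := (hnot ω).1 hc
      constructor
      · intro h; exact Or.inl ⟨hc', h.1, h.2⟩
      · rintro (h | h)
        · exact ⟨h.2.1, h.2.2⟩
        · exact absurd h.1 hc
  have hL' : (fun ω : BondConfig (Fin n) => insert s(o₁, o₂) ω) ⁻¹' L = X ∪ Y := by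
    ext ω
    simp only [mem_preimage, mem_setOf_eq, mem_union, hL, hX, hY]
    by_cases hc : ∃ x ∈ O, ω ∈ openConn v x
    · rw [filter_openConn_insert_of_conn A h12 ω hc]
      constructor
      · intro h; exact Or.inl ⟨hc, h⟩
      · rintro (h | h)
        · exact h.2
        · exact absurd hc ((hnot ω).2 h.1 |> fun h' => h')
    · have hc' := (hnot ω).1 hc
      rw [filter_openConn_insert_of_not A h12 ω hc']
      constructor
      · intro h; exact Or.inr ⟨hc', h⟩
      · rintro (h | h)
        · exact absurd h.1 hc
        · exact h.2
  have hLsplit : L = EB ∪ Y := by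
    ext ω
    simp only [mem_setOf_eq, mem_union, hL, hEB, hY]
    by_cases hc : ∃ x ∈ O, ω ∈ openConn v x
    · constructor
      · intro h; exact Or.inl ⟨hc, h⟩
      · rintro (h | h)
        · exact h.2
        · exact h.2
    · have hc' := (hnot ω).1 hc
      constructor
      · intro h; exact Or.inr ⟨hc', h⟩
      · rintro (h | h)
        · exact h.2
        · exact h.2
  have dEAX : Disjoint EA X := by
    rw [Set.disjoint_left]
    rintro ω ⟨h1, -⟩ ⟨⟨x, hx, hvx⟩, -⟩
    exact h1 x hx hvx
  have dXY : Disjoint X Y := by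
    rw [Set.disjoint_left]
    rintro ω ⟨⟨x, hx, hvx⟩, -⟩ ⟨h1, -⟩
    exact h1 x hx hvx
  have dEBY : Disjoint EB Y := by
    rw [Set.disjoint_left]
    rintro ω ⟨⟨x, hx, hvx⟩, -⟩ ⟨h1, -⟩
    exact h1 x hx hvx
  have hm : ∀ S : Set (BondConfig (Fin n)), MeasurableSet S := fun S => (Set.toFinite S).measurableSet
  rw [hB, hL', measureReal_union dEAX (hm X), measureReal_union dXY (hm Y)]
  conv_rhs => rw [hLsplit, measureReal_union dEBY (hm Y)]
  ring

/-- **Transfer along glued lightness.**  `o₁ ≠ o₂`, `w s(o₁,o₂) = 0`, relays `y, q ∈ A`, `w' = w[s(o₁,o₂) ↦ 1]`.  If `y` is a valid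
witness for the pair (`E_w(y) ≤ I_w(y)`) and `q` is no heavier than `y` in the GLUED weight function (`I_{w'}(y) ≤ I_{w'}(q)`), then `q` is a
valid witness (`E_w(q) ≤ I_w(q)`).  (Both margins equal `I_{w'}(·) − bad_{w'}(o₁)` by `obsE_pair_add_glued_lightness`.) [this work] -/
theorem obsE_le_of_valid_glued_heavier (w : Sym2 (Fin n) → unitInterval) (A : Finset (Fin n)) (o₁ o₂ y q : Fin n) (j : ℕ)
    (h12 : o₁ ≠ o₂) (hw : w s(o₁, o₂) = 0) (hy : y ∈ A) (hq : q ∈ A)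
    (hvalid : (prodBernoulli w).real {ω : BondConfig (Fin n) | (∀ x ∈ ({o₁, o₂} : Finset (Fin n)), ω ∉ openConn y x) ∧
          1 ≤ (A.filter fun z => ∃ x ∈ ({o₁, o₂} : Finset (Fin n)), ω ∈ openConn x z).card ∧
          (A.filter fun z => ∃ x ∈ ({o₁, o₂} : Finset (Fin n)), ω ∈ openConn x z).card ≤ j} +
        (prodBernoulli w).real {ω : BondConfig (Fin n) | (∃ x ∈ ({o₁, o₂} : Finset (Fin n)), ω ∈ openConn y x) ∧
          (A.filter fun z => ω ∈ openConn y z).card ≤ j} ≤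
        (prodBernoulli w).real {ω : BondConfig (Fin n) | (A.filter fun z => ω ∈ openConn y z).card ≤ j})
    (hglued : (prodBernoulli (Function.update w s(o₁, o₂) 1)).real
          {ω : BondConfig (Fin n) | (A.filter fun z => ω ∈ openConn y z).card ≤ j} ≤
        (prodBernoulli (Function.update w s(o₁, o₂) 1)).real
          {ω : BondConfig (Fin n) | (A.filter fun z => ω ∈ openConn q z).card ≤ j}) :
    (prodBernoulli w).real {ω : BondConfig (Fin n) | (∀ x ∈ ({o₁, o₂} : Finset (Fin n)), ω ∉ openConn q x) ∧
        1 ≤ (A.filter fun z => ∃ x ∈ ({o₁, o₂} : Finset (Fin n)), ω ∈ openConn x z).card ∧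
        (A.filter fun z => ∃ x ∈ ({o₁, o₂} : Finset (Fin n)), ω ∈ openConn x z).card ≤ j} +
      (prodBernoulli w).real {ω : BondConfig (Fin n) | (∃ x ∈ ({o₁, o₂} : Finset (Fin n)), ω ∈ openConn q x) ∧
        (A.filter fun z => ω ∈ openConn q z).card ≤ j} ≤
      (prodBernoulli w).real {ω : BondConfig (Fin n) | (A.filter fun z => ω ∈ openConn q z).card ≤ j} := by
  have hY := obsE_pair_add_glued_lightness w A o₁ o₂ y j h12 hw hy
  have hQ := obsE_pair_add_glued_lightness w A o₁ o₂ q j h12 hw hq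
  linarith

end HullPort

end Summit.CriticalPhenomena.PercolationContinuityZ3.Theorems

end
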